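import Literature.NumberTheory.Automorphic.PicardCMUniverse
import Literature.AlgebraicGeometry.HodgeTheory.BettiUniverseAxioms
import Literature.AlgebraicGeometry.HodgeTheory.ComplexOrientationFamily
import Literature.AlgebraicGeometry.HodgeTheory.ComplexGysinRational
import Literature.AlgebraicGeometry.HodgeTheory.SupportedClassesGysinSpan
import Literature.AlgebraicGeometry.HodgeTheory.HodgeRiemannPolarizabilityProofs
import Literature.AlgebraicGeometry.HodgeTheory.TopDegreeClasses
import HarnessLib

/-!
# COR-CM model layer, part 2: the Gysin / projection formula for a surface (`Fact_gysin_surface`)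
# on the Picard–CM model universe

Cell `pub-hodgecm2` (COR-CM), seat `model-1`.  Stage 1 (`pub-hodgecm`, `HodgeCM/Geometry/Facts.lean` l.206,
FACTS.md §1 row M26; `ModelAxioms` field 26, READ by the COR-CM end state through rfwf Prop 2.2,
`HodgeCM.Proofs.Prop22.Algebraic.gysinC`) asks of a universe `U`:

  `Fact_gysin_surface : ∀ (S X) (f : S ⟶ X), dim S = 2 → ∃ c ∈ alg X (dim X - 2), ∀ y : H⁴(X, ℚ),
     tr_S (f^* y) = tr_X (y ∪ c)`.

For the Picard–CM model universe (`HodgeCM.Model.universeOf`; tree objects `PicardCM.Var`,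
`BettiUniverse.tr/pull/cup`, `alg = PicardCM.ratAlgebraicClasses`) this file PROVES it from the tree:
for `f : S ⟶ X` smooth projective, `dim S = 2`, `dim X = n`,

* `n < 2`: `H⁴(X(ℂ); ℚ) = 0` (`Motives.ComplexPoints.subsingleton_singularCohomology_of_lt`), `c = 0`;
* `n = p + 2`: `c₀ := f_! 1 ∈ H^{2p}(X(ℂ); ℚ)`, the RATIONAL Gysin image of `1` for the rational
  complex orientations (`complexOrientationRat`, `gysinMap`; Poincaré duality `poincare_duality`); it is
  algebraic: its complexification is a non-zero multiple of `complexGysin complexOrientationFamily … 1`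
  (`complexGysin_ringChange_eq_smul_gysinMap`), which lies in `N^p H^{2p} = algebraicClasses X p`
  (`iSup_range_complexGysin_le_supportedClasses`); the projection formula `f_!(f^* y ∪ 1) = y ∪ f_! 1`
  (`gysinMap_map_cupProduct`, Fulton App. B (6)) gives `y ∪ c₀ = f_!(f^* y)` with `f_! : H⁴(S) → H^{2n}(X)`
  a map between two LINES (`finrank_rat_top`), so `tr_X ∘ f_! = r · tr_S`; and `r ≠ 0` because
  `f_! ≠ 0` in top degree: `f_! w ⌢ [X] = f(ℂ)_*(w ⌢ [S])` (`capProduct_gysinMap`) with `w ↦ w ⌢ [S]`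
  bijective and `f(ℂ)_*` injective on `H₀` (augmentation `ε`, `S(ℂ)` path connected); `c := r⁻¹ • c₀`.
  The light trace `BettiUniverse.tr` is a coordinate functional on the top line, not `∫`; the statement is
  insensitive to that normalisation (it is absorbed in `r`).

Print shape: Fulton, *Intersection Theory* §19.1 Lemma 19.1.2 and Prop. 8.3 (c) (cycle class of the
proper push-forward, projection formula) — here entirely a theorem of the tree's Gysin formalism.
-/

noncomputable section

open CategoryTheory
open Literature.AlgebraicTopology.SingularHomology
open Literature.AlgebraicGeometry.Motives (SchemeOver ComplexPoints IsSmoothProjective bettiCohomology)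
open Literature.AlgebraicGeometry.HodgeTheory
open Literature.NumberTheory.Automorphic.PicardCM

namespace Summit.HodgeConjecture.CorCM.Model

section General

variable {n m : ℕ} {X S : SchemeOver ℂ}

/-- Poincaré duality for the rational complex orientation of `X(ℂ)` (Hatcher Thm. 3.30, the tree's
`poincare_duality`). -/
theorem hasPoincareDuality_complexOrientationRat (hX : IsSmoothProjective n X) :
    (complexOrientationRat hX).HasPoincareDuality := fun _ _ h ↦
  Literature.AlgebraicGeometry.Motives.ComplexPoints.bijective_poincareDualityMap_of
    (fun ν _ _ h ↦ poincare_duality ν h) hX (complexOrientationRat hX) h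

/-- `X(ℂ)` is path connected for `X` smooth projective (connected: SGA1 XII 2.4, the tree's
`connectedSpace_complexPoints`; locally path connected as a manifold). (The same statement is
`Summit.HodgeConjecture.CorCM.Model.pathConnectedSpace_complexPoints` of the cell file `KunnethDegreeOne`
(p228559); a private copy keeps that file's Künneth cone out of this one.) -/
private theorem pathConnectedSpace_complexPoints' (hX : IsSmoothProjective n X) :
    PathConnectedSpace (ComplexPoints X) := by
  haveI := connectedSpace_complexPoints hX
  letI := hX.chartedSpace
  haveI : LocallyPathConnectedSpace (ComplexPoints X) :=
    ChartedSpace.locallyPathConnectedSpace (H := EuclideanSpace ℝ (Fin (2 * n))) (M := ComplexPoints X)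
  exact pathConnectedSpace_iff_connectedSpace.2 inferInstance

/-- `f(ℂ)_*` is injective on `H₀(–; ℚ)` for `S(ℂ)` path connected (the augmentation is an
isomorphism on `H₀` of a path-connected space and is natural, Hatcher Prop. 2.7 / §2.1). -/
theorem map_zero_injective (hS : IsSmoothProjective m S) (f : S ⟶ X) :
    Function.Injective
      (singularHomology.map ℚ ℚ (Literature.AlgebraicGeometry.Motives.AlgPoints.mapContinuous (L := ℂ) f) 0) := by
  haveI := pathConnectedSpace_complexPoints' hS
  haveI := singularHomology.isIso_ε_of_pathConnectedSpace ℚ ℚ (X := ComplexPoints S)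
  intro a b hab
  have h := singularHomology.map_ε (R := ℚ) (M := ℚ) (X := ComplexPoints S)
    (Literature.AlgebraicGeometry.Motives.AlgPoints.mapContinuous (L := ℂ) f)
  have ha : singularHomology.ε ℚ ℚ (ComplexPoints S) a = singularHomology.ε ℚ ℚ (ComplexPoints S) b := by
    rw [← h, ModuleCat.comp_apply, ModuleCat.comp_apply, hab]
  exact (ModuleCat.mono_iff_injective (singularHomology.ε ℚ ℚ (ComplexPoints S))).1 inferInstance ha

/-- The light trace in a top degree written `k` (`k = 2 dim X`): the coordinate functional along the
chosen basis vector of the line `Hᵏ(X(ℂ); ℚ)`. -/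
theorem tr_eq_coord (hX : IsSmoothProjective n X) {k : ℕ} (hk : k = 2 * n)
    (h1 : Module.finrank ℚ (bettiCohomology X k) = 1) :
    BettiUniverse.tr hX k = (BettiUniverse.lineBasis hX k h1).coord 0 := by
  unfold BettiUniverse.tr
  rw [dif_pos ⟨hk, h1⟩]

/-- On a line with basis `b` (indexed by `Fin 1`), every vector is `b.coord 0 v • b 0`. -/
theorem eq_coord_smul_of_basis {V : Type*} [AddCommGroup V] [Module ℚ V] (b : Module.Basis (Fin 1) ℚ V)
    (v : V) : v = b.coord 0 v • b 0 := by
  conv_lhs => rw [← b.sum_repr v]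
  rw [Fin.sum_univ_one]
  rfl

/-- Two linear functionals on a line are proportional (the non-zero one spans the dual line);
= `HodgeTheory.exists_eq_smul_of_finrank_eq_one` of `BettiUniverseTraceIntegral`, re-proved here to keep
that file (de Rham comparison) out of the import cone. -/
theorem exists_eq_smul_of_finrank_eq_one' {V : Type*} [AddCommGroup V] [Module ℚ V]
    (h1 : Module.finrank ℚ V = 1) (φ ψ : V →ₗ[ℚ] ℚ) (hψ : ψ ≠ 0) : ∃ c : ℚ, φ = c • ψ := by
  obtain ⟨v, hv⟩ := DFunLike.ne_iff.1 hψ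
  rw [LinearMap.zero_apply] at hv
  have hv0 : v ≠ 0 := fun h ↦ hv (by rw [h, map_zero])
  refine ⟨φ v / ψ v, LinearMap.ext fun w ↦ ?_⟩
  obtain ⟨a, rfl⟩ := (finrank_eq_one_iff_of_nonzero' v hv0).1 h1 w
  rw [LinearMap.smul_apply, map_smul, map_smul, smul_eq_mul, smul_eq_mul, smul_eq_mul]
  field_simp

/-! ### The two rational Gysin maps of `f : S ⟶ X`, `dim S = 2`, `dim X = p + 2`

No auxiliary definition is introduced (the file stays in the kernel-review lane): the top-degree Gysin map
`f_! : H⁴(S(ℂ); ℚ) → H^{4+2p}(X(ℂ); ℚ)` and the class `f_! 1 ∈ H^{2p}(X(ℂ); ℚ)` are written out as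
`gysinMap (complexOrientationRat hS) (complexOrientationRat hX) f(ℂ) …` for the rational complex orientations. -/

section Gysin

variable (p : ℕ) (hS : IsSmoothProjective 2 S) (hX : IsSmoothProjective (p + 2) X) (f : S ⟶ X)

/-- Projection formula: `f_!(f^* y) = y ∪ f_! 1` in `H^{4+2p}(X(ℂ); ℚ)` (Fulton App. B (6), the tree's
`gysinMap_map_cupProduct`, with `f^* y ∪ 1 = f^* y`). -/
theorem gysinTop_pull (y : bettiCohomology X 4) :
    gysinMap (complexOrientationRat hS) (complexOrientationRat hX)
      (Literature.AlgebraicGeometry.Motives.AlgPoints.mapContinuous (L := ℂ) f)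
      (show 4 + 0 = 2 * 2 from rfl) (show 4 + 2 * p + 0 = 2 * (p + 2) by ring) (BettiUniverse.pull f 4 y) =
      BettiUniverse.cup X 4 (2 * p) y
        (gysinMap (complexOrientationRat hS) (complexOrientationRat hX)
      (Literature.AlgebraicGeometry.Motives.AlgPoints.mapContinuous (L := ℂ) f)
      (show 0 + 2 * 2 = 2 * 2 from rfl) (show 2 * p + 2 * 2 = 2 * (p + 2) by ring) (singularCohomology.one ℚ (ComplexPoints S))) := by
  have h := gysinMap_map_cupProduct (μY := complexOrientationRat hS) (μX := complexOrientationRat hX)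
    (hasPoincareDuality_complexOrientationRat hX) (show Even (2 * 2 + 2 * (p + 2)) from ⟨p + 4, by ring⟩)
    (Literature.AlgebraicGeometry.Motives.AlgPoints.mapContinuous (L := ℂ) f)
    (p := 4) (a := 0) (s := 4) (q := 0) (t := 4 + 2 * p) (k := 2 * 2) (b := 2 * p)
    rfl rfl (by ring) rfl rfl (by ring) rfl y (singularCohomology.one ℚ (ComplexPoints S))
  rw [cupProduct_one] at h
  exact h

/-- `f_! 1` is a rational algebraic class of codimension `p`: its complexification is a non-zero multiple
of the complex Gysin image of `1` (`complexGysin_ringChange_eq_smul_gysinMap`), which lies in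
`N^p H^{2p}(X(ℂ); ℂ)` (`iSup_range_complexGysin_le_supportedClasses`). -/
theorem gysinUnit_mem :
    gysinMap (complexOrientationRat hS) (complexOrientationRat hX)
      (Literature.AlgebraicGeometry.Motives.AlgPoints.mapContinuous (L := ℂ) f)
      (show 0 + 2 * 2 = 2 * 2 from rfl) (show 2 * p + 2 * 2 = 2 * (p + 2) by ring) (singularCohomology.one ℚ (ComplexPoints S)) ∈
      ratAlgebraicClasses X p := by
  rw [mem_ratAlgebraicClasses_iff, ofRatClass_eq_ringChange]
  obtain ⟨u, hu, hug⟩ := complexGysin_ringChange_eq_smul_gysinMap (μ := complexOrientationFamily)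
    hasPoincareDuality_complexOrientationFamily hS hX f (a := 0) (b := 2 * p) (q := 2 * 2) rfl
    (by ring) (complexOrientationRat hS) (complexOrientationRat hX)
    (hasPoincareDuality_complexOrientationRat hX)
  have h1 : singularCohomology.ringChange (algebraMap ℚ ℂ) (ComplexPoints X) (2 * p)
        (gysinMap (complexOrientationRat hS) (complexOrientationRat hX)
          (Literature.AlgebraicGeometry.Motives.AlgPoints.mapContinuous (L := ℂ) f)
          (show 0 + 2 * 2 = 2 * 2 from rfl) (show 2 * p + 2 * 2 = 2 * (p + 2) by ring)
          (singularCohomology.one ℚ (ComplexPoints S))) =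
      u⁻¹ • complexGysin complexOrientationFamily hS hX f
        (show 0 + 2 * (p + 2) = 2 * p + 2 * 2 by ring)
        (singularCohomology.ringChange (algebraMap ℚ ℂ) (ComplexPoints S) 0
          (singularCohomology.one ℚ (ComplexPoints S))) := by
    rw [hug, smul_smul, inv_mul_cancel₀ hu, one_smul]
  rw [h1]
  refine Submodule.smul_mem _ _ ?_
  refine iSup_range_complexGysin_le_supportedClasses complexOrientationFamily hX (2 * p) p ?_
  refine Submodule.mem_iSup_of_mem 2 (Submodule.mem_iSup_of_mem (by omega)
    (Submodule.mem_iSup_of_mem S (Submodule.mem_iSup_of_mem hS (Submodule.mem_iSup_of_mem f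
      (Submodule.mem_iSup_of_mem 0 (Submodule.mem_iSup_of_mem (by ring) (LinearMap.mem_range_self _ _)))))))

/-- `f_!` is injective in top degree: `f_! w ⌢ [X] = f(ℂ)_*(w ⌢ [S])`, `w ↦ w ⌢ [S]` is injective
(Poincaré duality on `S`) and `f(ℂ)_*` is injective on `H₀` (`map_zero_injective`). -/
theorem gysinTop_eq_zero {w : bettiCohomology S 4}
    (hw : gysinMap (complexOrientationRat hS) (complexOrientationRat hX)
      (Literature.AlgebraicGeometry.Motives.AlgPoints.mapContinuous (L := ℂ) f)
      (show 4 + 0 = 2 * 2 from rfl) (show 4 + 2 * p + 0 = 2 * (p + 2) by ring) w = 0) : w = 0 := by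
  have hcap := capProduct_gysinMap (μY := complexOrientationRat hS)
    (hasPoincareDuality_complexOrientationRat hX)
    (Literature.AlgebraicGeometry.Motives.AlgPoints.mapContinuous (L := ℂ) f)
    (show 4 + 0 = 2 * 2 from rfl) (show 4 + 2 * p + 0 = 2 * (p + 2) by ring) w
  rw [hw, LinearMap.map_zero₂] at hcap
  have hzero : capProduct (show 4 + 0 = 2 * 2 from rfl) w (complexOrientationRat hS).fundamentalClass = 0 :=
    map_zero_injective hS f (X := X) (by rw [← hcap, map_zero])
  refine (hasPoincareDuality_complexOrientationRat hS (show 4 + 0 = 2 * 2 from rfl)).1 ?_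
  rw [poincareDualityMap_apply, hzero, poincareDualityMap_apply, LinearMap.map_zero₂]

/-- For an injective-in-effect `g : H⁴(S; ℚ) → H^{4+2p}(X; ℚ)` (`g w = 0 → w = 0`) between the two top
LINES, the scalar `r` with `tr_X ∘ g = r • tr_S` is non-zero (`tr_X` is a coordinate functional). -/
theorem scalar_ne_zero_of_injective (h1S : Module.finrank ℚ (bettiCohomology S 4) = 1)
    (h1X : Module.finrank ℚ (bettiCohomology X (4 + 2 * p)) = 1)
    (g : bettiCohomology S 4 →ₗ[ℚ] bettiCohomology X (4 + 2 * p)) (hg : ∀ w, g w = 0 → w = 0) (r : ℚ)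
    (hr : BettiUniverse.tr hX (4 + 2 * p) ∘ₗ g = r • BettiUniverse.tr hS 4) : r ≠ 0 := by
  have htrX : BettiUniverse.tr hX (4 + 2 * p) = (BettiUniverse.lineBasis hX (4 + 2 * p) h1X).coord 0 :=
    tr_eq_coord hX (by ring) h1X
  rintro rfl
  rw [zero_smul] at hr
  have hw0 : BettiUniverse.lineBasis hS 4 h1S 0 ≠ 0 := (BettiUniverse.lineBasis hS 4 h1S).ne_zero 0
  refine hw0 (hg _ ?_)
  have h := LinearMap.congr_fun hr (BettiUniverse.lineBasis hS 4 h1S 0)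
  rw [LinearMap.zero_apply, LinearMap.comp_apply, htrX] at h
  rw [eq_coord_smul_of_basis (BettiUniverse.lineBasis hX (4 + 2 * p) h1X) (g _), h, zero_smul]

/-- The trace identity for `c := r⁻¹ • c₀`, given the projection formula `g (f^* y) = y ∪ c₀` and
`tr_X ∘ g = r • tr_S` with `r ≠ 0`. -/
theorem trace_identity_of_proj (g : bettiCohomology S 4 →ₗ[ℚ] bettiCohomology X (4 + 2 * p))
    (c₀ : bettiCohomology X (2 * p))
    (hproj : ∀ y : bettiCohomology X 4, g (BettiUniverse.pull f 4 y) = BettiUniverse.cup X 4 (2 * p) y c₀)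
    (r : ℚ) (hr0 : r ≠ 0) (hr : BettiUniverse.tr hX (4 + 2 * p) ∘ₗ g = r • BettiUniverse.tr hS 4)
    (y : bettiCohomology X 4) :
    BettiUniverse.tr hS 4 (BettiUniverse.pull f 4 y) =
      BettiUniverse.tr hX (4 + 2 * p) (BettiUniverse.cup X 4 (2 * p) y (r⁻¹ • c₀)) := by
  have key := LinearMap.congr_fun hr (BettiUniverse.pull f 4 y)
  rw [LinearMap.comp_apply, LinearMap.smul_apply, hproj] at key
  rw [LinearMap.map_smul, LinearMap.map_smul, key, smul_eq_mul, smul_eq_mul, ← mul_assoc,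
    inv_mul_cancel₀ hr0, one_mul]

/-- **`Fact_gysin_surface`, main case `dim X = p + 2`.** -/
theorem exists_gysin_surface_aux :
    ∃ c ∈ ratAlgebraicClasses X p, ∀ y : bettiCohomology X 4,
      BettiUniverse.tr hS 4 (BettiUniverse.pull f 4 y) =
        BettiUniverse.tr hX (4 + 2 * p) (BettiUniverse.cup X 4 (2 * p) y c) := by
  have h1S : Module.finrank ℚ (bettiCohomology S 4) = 1 := finrank_rat_top hS
  have h1X : Module.finrank ℚ (bettiCohomology X (4 + 2 * p)) = 1 := by
    rw [show 4 + 2 * p = 2 * (p + 2) by ring]; exact finrank_rat_top hX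
  obtain ⟨r, hr⟩ := exists_eq_smul_of_finrank_eq_one' h1S
    (BettiUniverse.tr hX (4 + 2 * p) ∘ₗ
      gysinMap (complexOrientationRat hS) (complexOrientationRat hX)
      (Literature.AlgebraicGeometry.Motives.AlgPoints.mapContinuous (L := ℂ) f)
      (show 4 + 0 = 2 * 2 from rfl) (show 4 + 2 * p + 0 = 2 * (p + 2) by ring)) (BettiUniverse.tr hS 4)
    (BettiUniverse.tr_ne_zero hS h1S)
  have hr0 : r ≠ 0 :=
    scalar_ne_zero_of_injective p hS hX h1S h1X _ (fun w hw ↦ gysinTop_eq_zero p hS hX f hw) r hr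
  exact ⟨_, (ratAlgebraicClasses X p).smul_mem r⁻¹ (gysinUnit_mem p hS hX f),
    trace_identity_of_proj p hS hX f _ _ (gysinTop_pull p hS hX f) r hr0 hr⟩

end Gysin

/-- **`Fact_gysin_surface` on the tree objects of the model**: for `f : S ⟶ X` smooth projective with
`dim S = 2`, there is a rational algebraic class `c` of codimension `dim X - 2` with
`tr_S (f^* y) = tr_X (y ∪ c)` for all `y ∈ H⁴(X(ℂ); ℚ)` (light traces `BettiUniverse.tr`). -/
theorem exists_gysin_surface (hS : IsSmoothProjective m S) (hm : m = 2) (hX : IsSmoothProjective n X)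
    (f : S ⟶ X) :
    ∃ c ∈ ratAlgebraicClasses X (n - 2), ∀ y : bettiCohomology X 4,
      BettiUniverse.tr hS 4 (BettiUniverse.pull f 4 y) =
        BettiUniverse.tr hX (4 + 2 * (n - 2)) (BettiUniverse.cup X 4 (2 * (n - 2)) y c) := by
  subst hm
  rcases lt_or_ge n 2 with hn | hn
  · haveI : Subsingleton (bettiCohomology X 4) :=
      Literature.AlgebraicGeometry.Motives.ComplexPoints.subsingleton_singularCohomology_of_lt hX ℚ (by omega)
    refine ⟨0, Submodule.zero_mem _, fun y ↦ ?_⟩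
    rw [Subsingleton.elim y 0, map_zero, map_zero, LinearMap.map_zero₂, map_zero]
  · obtain ⟨p, rfl⟩ : ∃ p, n = p + 2 := ⟨n - 2, by omega⟩
    exact exists_gysin_surface_aux p hS hX f

end General

/-! ### The package shape on `PicardCM.Var` -/

section PicardCMVar

/-- `Fact_gysin_surface` of the model universe `universeOf hHD hI hU h₃` (binders `hU`, `h₃` only: traces,
pull-backs, cup products and `alg` of the model do not involve the Hodge structure). -/
theorem var_gysin_surface (hU : BallQuotientUniformisedDatum) (h₃ : CMAbelianVarietyRealised) (S X : Var)
    (f : Var.Mor hU h₃ S X) (hS : S.dim = 2) :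
    ∃ c ∈ Var.alg hU h₃ X (X.dim - 2), ∀ y : Var.Coh hU h₃ X 4,
      BettiUniverse.tr (Var.isSmoothProjective hU h₃ S) 4 (BettiUniverse.pull f 4 y) =
        BettiUniverse.tr (Var.isSmoothProjective hU h₃ X) (4 + 2 * (X.dim - 2))
          (BettiUniverse.cup (Var.scheme hU h₃ X) 4 (2 * (X.dim - 2)) y c) :=
  exists_gysin_surface (Var.isSmoothProjective hU h₃ S) hS (Var.isSmoothProjective hU h₃ X) f

end PicardCMVar

end Summit.HodgeConjecture.CorCM.Model

end
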